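import Mathlib
import Literature.MathematicalPhysics.QuantumManyBody.BoseEinsteinCondensation
import Summits.AtomisticToContinuum.BoseEinsteinCondensation.Theorems.SoloBlindBhattacharyya
import Summits.AtomisticToContinuum.BoseEinsteinCondensation.Theorems.SoloBlindTrialStateCriterion

/-!
# `L²`-stability of the mode occupation

Solo seat `solo-AtomisticToContinuum-blind`, conjunct `BoseEinsteinCondensation`.

The criteria of the `SoloBlind*` files bound `maxOccupation` of a **real nonnegative** amplitude
`Φ` from below, while `BoseGas.condensateNumber` infimises over all `δ`-near-minimisers `Ψ`, which
are complex.  The bridge at fixed `N, L` is (i) compactness: near-minimisers are `L²`-close to the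
positive ground state modulo a phase (not formalised), and (ii) the present elementary estimate:
the square root of the occupation `Y ↦ ‖∫ conj φ · Ψ(· :: Y)‖` is `1`-Lipschitz in `Ψ` for the norm
`√(n+1) ‖·‖_{L²}`:

`occupation (n+1) φ Ψ ^ (1/2) ≤ occupation (n+1) φ Ψ' ^ (1/2) + ((n+1) ∫ |Ψ − Ψ'|²) ^ (1/2)`

(`sqrt_occupation_le_add`), by Minkowski in `L²(dY)` and Cauchy–Schwarz in `dx`.  Consequently an
amplitude within `L²`-distance `ε` of a nonnegative `Φ` with affinity `BC ≥ b` has a mode occupied by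
`≥ (n+1)(b − ε)²` particles (`mul_sq_sub_le_maxOccupation_of_near`): closeness at *fixed* order `ε < b`
suffices, no `N`-dependence is required of `ε`.
-/

open MeasureTheory
open scoped ENNReal

namespace Summit.AtomisticToContinuum.BoseEinsteinCondensation.Theorems

open Literature.MathematicalPhysics.QuantumManyBody.BoseGas

/-- Minkowski in `L²`, in the form used below: if `u ≤ v + w` a.e. then
`(∫ u²)^{1/2} ≤ (∫ v²)^{1/2} + (∫ w²)^{1/2}`. -/
theorem lintegral_sq_rpow_half_le_add {β : Type*} [MeasurableSpace β] (μ : Measure β)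
    {u v w : β → ℝ≥0∞} (hv : AEMeasurable v μ) (hw : AEMeasurable w μ)
    (h : ∀ᵐ y ∂μ, u y ≤ v y + w y) :
    (∫⁻ y, u y ^ 2 ∂μ) ^ (1 / 2 : ℝ) ≤
      (∫⁻ y, v y ^ 2 ∂μ) ^ (1 / 2 : ℝ) + (∫⁻ y, w y ^ 2 ∂μ) ^ (1 / 2 : ℝ) := by
  have hmono : ∫⁻ y, u y ^ 2 ∂μ ≤ ∫⁻ y, (v + w) y ^ 2 ∂μ :=
    lintegral_mono_ae (h.mono fun y hy => by simpa using pow_le_pow_left' hy 2)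
  have hmink := ENNReal.lintegral_Lp_add_le (p := 2) hv hw (by norm_num)
  simp only [ENNReal.rpow_two] at hmink
  exact (ENNReal.rpow_le_rpow hmono (by norm_num)).trans hmink

/-- **`L²`-stability of the occupation.** For a mode `φ` with `∫ |φ|² ≤ 1` and amplitudes `Ψ, Ψ'`
(with the one-particle pairings integrable for a.e. configuration of the other particles):
`occupation φ Ψ ^ (1/2) ≤ occupation φ Ψ' ^ (1/2) + ((n+1) ‖Ψ − Ψ'‖²_{L²}) ^ (1/2)`. -/
theorem sqrt_occupation_le_add {n : ℕ} {φ : Space → ℂ} {Ψ Ψ' : Config (n + 1) → ℂ}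
    (hφm : Measurable φ) (hΨm : Measurable Ψ) (hΨ'm : Measurable Ψ')
    (hφ1 : ∫⁻ x, (‖φ x‖₊ : ℝ≥0∞) ^ 2 ≤ 1)
    (hint : ∀ᵐ Y : Config n,
      Integrable (fun x => (starRingEnd ℂ) (φ x) * Ψ (Matrix.vecCons x Y)))
    (hint' : ∀ᵐ Y : Config n,
      Integrable (fun x => (starRingEnd ℂ) (φ x) * Ψ' (Matrix.vecCons x Y))) :
    occupation (n + 1) φ Ψ ^ (1 / 2 : ℝ) ≤
      occupation (n + 1) φ Ψ' ^ (1 / 2 : ℝ) +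
        ((n + 1 : ℝ≥0∞) * ∫⁻ X, (‖Ψ X - Ψ' X‖₊ : ℝ≥0∞) ^ 2) ^ (1 / 2 : ℝ) := by
  -- measurability of the ingredients
  have hconj : Measurable fun x => (starRingEnd ℂ) (φ x) :=
    Complex.continuous_conj.measurable.comp hφm
  have hF' : Measurable fun z : Space × Config n =>
      (starRingEnd ℂ) (φ z.1) * Ψ' (Matrix.vecCons z.1 z.2) :=
    (hconj.comp measurable_fst).mul (hΨ'm.comp measurable_vecCons)
  have hb : AEMeasurable (fun Y : Config n =>
      (‖∫ x, (starRingEnd ℂ) (φ x) * Ψ' (Matrix.vecCons x Y)‖₊ : ℝ≥0∞)) volume :=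
    (hF'.stronglyMeasurable.integral_prod_left').measurable.nnnorm.coe_nnreal_ennreal.aemeasurable
  have hD : Measurable fun z : Space × Config n =>
      (‖Ψ (Matrix.vecCons z.1 z.2) - Ψ' (Matrix.vecCons z.1 z.2)‖₊ : ℝ≥0∞) :=
    ((hΨm.comp measurable_vecCons).sub (hΨ'm.comp measurable_vecCons)).nnnorm.coe_nnreal_ennreal
  have hG : Measurable fun z : Space × Config n =>
      (‖φ z.1‖₊ : ℝ≥0∞) * (‖Ψ (Matrix.vecCons z.1 z.2) - Ψ' (Matrix.vecCons z.1 z.2)‖₊ : ℝ≥0∞) :=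
    (hφm.nnnorm.coe_nnreal_ennreal.comp measurable_fst).mul hD
  have hw : Measurable fun Y : Config n =>
      ∫⁻ x, (‖φ x‖₊ : ℝ≥0∞) * (‖Ψ (Matrix.vecCons x Y) - Ψ' (Matrix.vecCons x Y)‖₊ : ℝ≥0∞) :=
    hG.lintegral_prod_left'
  -- pointwise (a.e. in `Y`): triangle inequality and `‖∫ f‖ ≤ ∫ ‖f‖`
  have hpt : ∀ᵐ Y : Config n,
      (‖∫ x, (starRingEnd ℂ) (φ x) * Ψ (Matrix.vecCons x Y)‖₊ : ℝ≥0∞) ≤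
        (‖∫ x, (starRingEnd ℂ) (φ x) * Ψ' (Matrix.vecCons x Y)‖₊ : ℝ≥0∞) +
          ∫⁻ x, (‖φ x‖₊ : ℝ≥0∞) *
            (‖Ψ (Matrix.vecCons x Y) - Ψ' (Matrix.vecCons x Y)‖₊ : ℝ≥0∞) := by
    filter_upwards [hint, hint'] with Y hY hY'
    have hsub : (∫ x, (starRingEnd ℂ) (φ x) * Ψ (Matrix.vecCons x Y)) -
        ∫ x, (starRingEnd ℂ) (φ x) * Ψ' (Matrix.vecCons x Y) =
        ∫ x, (starRingEnd ℂ) (φ x) * (Ψ (Matrix.vecCons x Y) - Ψ' (Matrix.vecCons x Y)) := by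
      rw [← integral_sub hY hY']
      refine integral_congr_ae (ae_of_all _ fun x => ?_)
      simp only [mul_sub]
    have htri : (‖∫ x, (starRingEnd ℂ) (φ x) * Ψ (Matrix.vecCons x Y)‖₊ : ℝ≥0∞) ≤
        (‖∫ x, (starRingEnd ℂ) (φ x) * Ψ' (Matrix.vecCons x Y)‖₊ : ℝ≥0∞) +
          ‖(∫ x, (starRingEnd ℂ) (φ x) * Ψ (Matrix.vecCons x Y)) -
            ∫ x, (starRingEnd ℂ) (φ x) * Ψ' (Matrix.vecCons x Y)‖₊ := by
      have := nnnorm_add_le (∫ x, (starRingEnd ℂ) (φ x) * Ψ' (Matrix.vecCons x Y))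
        ((∫ x, (starRingEnd ℂ) (φ x) * Ψ (Matrix.vecCons x Y)) -
          ∫ x, (starRingEnd ℂ) (φ x) * Ψ' (Matrix.vecCons x Y))
      rw [add_sub_cancel] at this
      exact_mod_cast this
    refine htri.trans (add_le_add le_rfl ?_)
    rw [hsub]
    refine (enorm_integral_le_lintegral_enorm _).trans (le_of_eq (lintegral_congr fun x => ?_))
    rw [enorm_mul, RCLike.enorm_conj]
    rfl
  -- Cauchy–Schwarz in `x`, then the split `∫ dY ∫ dx = ∫ dX`
  have hw2 : ∫⁻ Y : Config n, (∫⁻ x, (‖φ x‖₊ : ℝ≥0∞) *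
      (‖Ψ (Matrix.vecCons x Y) - Ψ' (Matrix.vecCons x Y)‖₊ : ℝ≥0∞)) ^ 2 ≤
      ∫⁻ X, (‖Ψ X - Ψ' X‖₊ : ℝ≥0∞) ^ 2 := by
    have hmeas : Measurable fun X : Config (n + 1) => (‖Ψ X - Ψ' X‖₊ : ℝ≥0∞) ^ 2 :=
      ((hΨm.sub hΨ'm).nnnorm.coe_nnreal_ennreal).pow_const 2
    rw [lintegral_eq_lintegral_lintegral_vecCons hmeas]
    refine lintegral_mono fun Y => ?_
    have hDY : AEMeasurable (fun x : Space =>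
        (‖Ψ (Matrix.vecCons x Y) - Ψ' (Matrix.vecCons x Y)‖₊ : ℝ≥0∞)) volume :=
      (hD.comp (measurable_id.prodMk measurable_const)).aemeasurable
    calc (∫⁻ x, (‖φ x‖₊ : ℝ≥0∞) * (‖Ψ (Matrix.vecCons x Y) - Ψ' (Matrix.vecCons x Y)‖₊ : ℝ≥0∞)) ^ 2
        ≤ (∫⁻ x, (‖φ x‖₊ : ℝ≥0∞) ^ 2) *
            ∫⁻ x, (‖Ψ (Matrix.vecCons x Y) - Ψ' (Matrix.vecCons x Y)‖₊ : ℝ≥0∞) ^ 2 :=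
          lintegral_mul_sq_le_lintegral_sq_mul volume
            hφm.nnnorm.coe_nnreal_ennreal.aemeasurable hDY
      _ ≤ 1 * ∫⁻ x, (‖Ψ (Matrix.vecCons x Y) - Ψ' (Matrix.vecCons x Y)‖₊ : ℝ≥0∞) ^ 2 :=
          mul_le_mul' hφ1 le_rfl
      _ = _ := one_mul _
  -- Minkowski in `Y`
  have hM := lintegral_sq_rpow_half_le_add (volume : Measure (Config n)) hb hw.aemeasurable hpt
  -- assemble
  have hocc : occupation (n + 1) φ Ψ = (n + 1 : ℝ≥0∞) *
      ∫⁻ Y : Config n, (‖∫ x, (starRingEnd ℂ) (φ x) * Ψ (Matrix.vecCons x Y)‖₊ : ℝ≥0∞) ^ 2 := by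
    simp only [occupation]
  have hocc' : occupation (n + 1) φ Ψ' = (n + 1 : ℝ≥0∞) *
      ∫⁻ Y : Config n, (‖∫ x, (starRingEnd ℂ) (φ x) * Ψ' (Matrix.vecCons x Y)‖₊ : ℝ≥0∞) ^ 2 := by
    simp only [occupation]
  rw [hocc, hocc', ENNReal.mul_rpow_of_nonneg _ _ (by norm_num : (0 : ℝ) ≤ 1 / 2),
    ENNReal.mul_rpow_of_nonneg _ _ (by norm_num : (0 : ℝ) ≤ 1 / 2),
    ENNReal.mul_rpow_of_nonneg _ _ (by norm_num : (0 : ℝ) ≤ 1 / 2), ← mul_add]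
  refine mul_le_mul' le_rfl (hM.trans (add_le_add le_rfl ?_))
  exact ENNReal.rpow_le_rpow hw2 (by norm_num)

/-- **Occupation of a near-positive amplitude.** If `Φ ≥ 0` has Bhattacharyya affinity `≥ b` to its
resampling by the normalised mode `g ≥ 0`, and `Ψ` is any amplitude with `(n+1)‖Ψ − Φ‖²_{L²} ≤ (n+1) ε²`
(i.e. `‖Ψ − Φ‖_{L²} ≤ ε`), then the mode `g` is occupied in `Ψ` by at least `(n+1)(b − ε)²` particles:
`(n+1) (b − ε)² ≤ maxOccupation (n+1) Ψ`.  (Truncated subtraction in `ℝ≥0∞`.) -/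
theorem mul_sq_sub_le_maxOccupation_of_near {n : ℕ} {g : Space → ℝ} {Φ : Config (n + 1) → ℝ}
    {Ψ : Config (n + 1) → ℂ} (hg0 : 0 ≤ g) (hΦ0 : 0 ≤ Φ) (hgm : Measurable g) (hΦm : Measurable Φ)
    (hΨm : Measurable Ψ)
    (hint : ∀ Y : Config n, Integrable (fun x => g x * Φ (Matrix.vecCons x Y)))
    (hintΨ : ∀ᵐ Y : Config n,
      Integrable (fun x => (starRingEnd ℂ) ((g x : ℂ)) * Ψ (Matrix.vecCons x Y)))
    (hg1 : ∫⁻ x, ENNReal.ofReal (g x) ^ 2 = 1)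
    (hΦ1 : ∫⁻ Y : Config n, ∫⁻ x, ENNReal.ofReal (Φ (Matrix.vecCons x Y)) ^ 2 = 1) {b ε : ℝ≥0∞}
    (hb : b ≤ ∫⁻ Y : Config n, (∫⁻ x, ENNReal.ofReal (g x) * ENNReal.ofReal (Φ (Matrix.vecCons x Y))) *
          (∫⁻ x, ENNReal.ofReal (Φ (Matrix.vecCons x Y)) ^ 2) ^ (1 / 2 : ℝ))
    (hε : ∫⁻ X, (‖Ψ X - (Φ X : ℂ)‖₊ : ℝ≥0∞) ^ 2 ≤ ε ^ 2) :
    (n + 1 : ℝ≥0∞) * (b - ε) ^ 2 ≤ maxOccupation (n + 1) Ψ := by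
  -- the occupation of `g` in `Φ` is at least `(n+1) b²`
  have hsand := (occupation_bhattacharyya_sandwich hg0 hΦ0 hgm hΦm hint hg1.le hΦ1).1
  have hoccΦ : (n + 1 : ℝ≥0∞) * b ^ 2 ≤
      occupation (n + 1) (fun x => (g x : ℂ)) (fun X => (Φ X : ℂ)) :=
    le_trans (mul_le_mul' le_rfl (pow_le_pow_left' hb 2)) hsand
  -- stability, with `Ψ' = Φ`
  have hφm : Measurable fun x => (g x : ℂ) := Complex.measurable_ofReal.comp hgm
  have hΦm' : Measurable fun X => (Φ X : ℂ) := Complex.measurable_ofReal.comp hΦm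
  have hφ1 : ∫⁻ x, (‖(g x : ℂ)‖₊ : ℝ≥0∞) ^ 2 ≤ 1 := by
    rw [← hg1]
    refine le_of_eq (lintegral_congr fun x => ?_)
    rw [coe_nnnorm_ofReal_of_nonneg (hg0 x)]
  have hintΦ : ∀ᵐ Y : Config n,
      Integrable (fun x => (starRingEnd ℂ) ((g x : ℂ)) * ((Φ (Matrix.vecCons x Y) : ℝ) : ℂ)) := by
    refine ae_of_all _ fun Y => ?_
    have hfun : (fun x => (starRingEnd ℂ) ((g x : ℂ)) * ((Φ (Matrix.vecCons x Y) : ℝ) : ℂ)) =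
        fun x => ((g x * Φ (Matrix.vecCons x Y) : ℝ) : ℂ) := by
      funext x
      simp only [Complex.conj_ofReal, Complex.ofReal_mul]
    rw [hfun]
    exact (hint Y).ofReal
  have hstab := sqrt_occupation_le_add hφm hΦm' hΨm hφ1 hintΦ hintΨ
  have hε' : ∫⁻ X, (‖(Φ X : ℂ) - Ψ X‖₊ : ℝ≥0∞) ^ 2 ≤ ε ^ 2 :=
    le_trans (le_of_eq (lintegral_congr fun X => by rw [← nnnorm_neg, neg_sub])) hε
  -- `√((n+1)) b ≤ √occ(Φ) ≤ √occ(Ψ) + √(n+1) ε`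
  have h1 : ((n + 1 : ℝ≥0∞) * b ^ 2) ^ (1 / 2 : ℝ) ≤
      occupation (n + 1) (fun x => (g x : ℂ)) Ψ ^ (1 / 2 : ℝ) +
        ((n + 1 : ℝ≥0∞) * ε ^ 2) ^ (1 / 2 : ℝ) := by
    refine (ENNReal.rpow_le_rpow hoccΦ (by norm_num)).trans (hstab.trans (add_le_add le_rfl ?_))
    exact ENNReal.rpow_le_rpow (mul_le_mul' le_rfl hε') (by norm_num)
  have hsq : ∀ c : ℝ≥0∞, ((n + 1 : ℝ≥0∞) * c ^ 2) ^ (1 / 2 : ℝ) =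
      (n + 1 : ℝ≥0∞) ^ (1 / 2 : ℝ) * c := by
    intro c
    rw [ENNReal.mul_rpow_of_nonneg _ _ (by norm_num : (0 : ℝ) ≤ 1 / 2), ← ENNReal.rpow_two,
      ← ENNReal.rpow_mul]
    norm_num
  rw [hsq, hsq] at h1
  -- hence `√(n+1) (b - ε) ≤ √occ(Ψ)`
  have h2 : (n + 1 : ℝ≥0∞) ^ (1 / 2 : ℝ) * (b - ε) ≤
      occupation (n + 1) (fun x => (g x : ℂ)) Ψ ^ (1 / 2 : ℝ) := by
    rw [ENNReal.mul_sub (fun _ _ => by simp)]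
    exact tsub_le_iff_right.mpr h1
  -- square
  have h3 : ((n + 1 : ℝ≥0∞) ^ (1 / 2 : ℝ) * (b - ε)) ^ 2 ≤
      occupation (n + 1) (fun x => (g x : ℂ)) Ψ := by
    have := pow_le_pow_left' h2 2
    rwa [← ENNReal.rpow_two (occupation _ _ _ ^ (1 / 2 : ℝ)), ← ENNReal.rpow_mul,
      show (1 / 2 : ℝ) * 2 = 1 by norm_num, ENNReal.rpow_one] at this
  have h4 : ((n + 1 : ℝ≥0∞) ^ (1 / 2 : ℝ) * (b - ε)) ^ 2 = (n + 1 : ℝ≥0∞) * (b - ε) ^ 2 := by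
    rw [mul_pow, ← ENNReal.rpow_two ((n + 1 : ℝ≥0∞) ^ (1 / 2 : ℝ)), ← ENNReal.rpow_mul]
    norm_num
  rw [h4] at h3
  refine h3.trans (occupation_le_maxOccupation _ ?_ ?_)
  · exact hφm.aestronglyMeasurable
  · rw [← hg1]
    refine lintegral_congr fun x => ?_
    rw [coe_nnnorm_ofReal_of_nonneg (hg0 x)]

end Summit.AtomisticToContinuum.BoseEinsteinCondensation.Theorems
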